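import Literature.MathematicalPhysics.QuantumLattice.SpinChargeTransportIndex
import HarnessLib

/-!
# The spin Lieb–Schultz–Mattis index in the regime `h = L/2`, `m = L/8`, `r = L/16`, `a = g/L`:
# an error `poly(|Λ|, L, 1/g) · e^{-κ g L}`

Sequel of `SpinChargeTransportIndex.lean` (sub-namespace `SpinLSM`): the quantitative index theorem
`exists_int_abs_expect_plane_sub_le` (Bachmann–Bols–De Roeck–Fraas, CMP **375** (2019), Thm 2.1 with
Prop. 2.4, for a strict translation symmetry of a spin-`1/2` system, with Hastings' Gaussian
dressing) is specialised to the regime of scales `h = L/2`, `m = L/8`, `r = L/16` and the Gaussian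
rate `a = g/L` of Hastings (PRB **69** (2004) 104431, §II–III) / Nachtergaele–Sims (CMP **276**
(2007), §3: `a = γ_L/L`), for `L ≥ rateL0` and a gap parameter `0 < g ≤ 1`. All four small
quantities — the spectral error `e^{-g²/(4a)} = e^{-gL/4}`, the Lieb–Robinson part
`e^{-(R-r₀)/(2(r₀+1))} ≤ e^{-L/(64(r₀+1))}` and the Gaussian time tail `e^{-aT²} ≤ e^{-gL/(4096v²)}`
of `δ_K`, and the strip clustering `e^{-(D-r₀)/ξ} ≤ e^{-L/(64(r₀+1))} + e^{-gL/(32v)}` — are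
`≤ e^{-κ g L}` with `κ = rateKappa r₀ V J > 0`, whence (`exists_int_abs_sub_le_of_regime`)

`dist(⟨ψ, Q_{slab [0]} ψ⟩, ℤ) ≤ rateConst · |Λ|² L² g⁻² · e^{-κ g L / 2}`

with constants depending only on `(r₀, V, J)`. This exponential-in-`gL` error (as opposed to the
`O(L^{-∞})` of the exact quasi-adiabatic dressing) is what yields the `C log L / L` bound on the gap.
Theorems + explicit constants (`def`s with bodies); no named facts.

## References

* S. Bachmann, A. Bols, W. De Roeck, M. Fraas, Comm. Math. Phys. **375** (2019) 1249, Thm 2.1,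
  Prop. 2.4, §3.2. [BachmannEtAl2019]
* M. B. Hastings, Phys. Rev. B **69** (2004) 104431, §II–III. [HastingsPRB2004]
* B. Nachtergaele, R. Sims, Comm. Math. Phys. **276** (2007) 437, §1.3 and §3 (the choice
  `a = γ_L/L`, errors `C L^ν e^{-cγ_L L}`). [NachtergaeleSimsCMP2007]
* The tree: `SpinChargeTransportIndex` (`Setting`, `exists_int_abs_expect_plane_sub_le`,
  `ballM_separation`, `norm_dM_le`, `norm_kM_le`), `SpinChargeTransportLocality`
  (`norm_kLocG_sub_kTildeG_le`, `norm_windowCurrent_le`), `ChargeTransportIndex` (`errShape_le`).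
-/

noncomputable section

namespace Literature.MathematicalPhysics.QuantumLattice

open Matrix Complex Finset
open scoped Matrix.Norms.L2Operator ComplexOrder

namespace SpinLSM

/-! ### Elementary real inequalities -/

section Real

/-- `e^{-x/max(A,B)} ≤ e^{-x/A} + e^{-x/B}`. [folklore] -/
theorem exp_neg_div_max_le (x A B : ℝ) :
    Real.exp (-x / max A B) ≤ Real.exp (-x / A) + Real.exp (-x / B) := by
  rcases le_total A B with hAB | hAB
  · rw [max_eq_right hAB]
    linarith [Real.exp_nonneg (-x / A)]
  · rw [max_eq_left hAB]
    linarith [Real.exp_nonneg (-x / B)]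

/-- Monotonicity of `e^{-c x}` in the rate: `e^{-c x} ≤ e^{-κ x}` for `κ ≤ c`, `x ≥ 0`. [folklore] -/
theorem exp_neg_mul_le_of_le {κ c x : ℝ} (h : κ ≤ c) (hx : 0 ≤ x) :
    Real.exp (-(c * x)) ≤ Real.exp (-(κ * x)) :=
  Real.exp_le_exp.2 (by nlinarith)

end Real

/-! ### The constants -/

section Constants

variable (r₀ V : ℕ) (J : ℝ)

/-- The exponential rate `κ = min(1/4, 1/(64(r₀+1)), 1/(4096 v²), 1/(32 v))`, `v = lrVelocity`.
[folklore] -/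
def rateKappa : ℝ :=
  min (min (1 / 4) (1 / (64 * ((r₀ : ℝ) + 1))))
    (min (1 / (4096 * lrVelocity r₀ V J ^ 2)) (1 / (32 * lrVelocity r₀ V J)))

/-- The threshold `L₀ = 64(r₀+1) + 16(⌈v⌉₊+1)` of the regime. [folklore] -/
def rateL0 : ℕ := 64 * (r₀ + 1) + 16 * (⌈lrVelocity r₀ V J⌉₊ + 1)

/-- The constant `C₁' = 2 + 4J + 8(r₀+1)/v + 8v` of the strip clustering (times `1/g`). [folklore] -/
def rateC1 : ℝ := 2 + 4 * J + 8 * ((r₀ : ℝ) + 1) / lrVelocity r₀ V J + 8 * lrVelocity r₀ V J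

/-- The constant `K_X = 4√π V²J² + 256 V J v + 1/2 + 2C₁'` of `X = δ_K + ε_s/2 + clustK`. [folklore] -/
def rateKX : ℝ :=
  4 * Real.sqrt Real.pi * (V : ℝ) ^ 2 * J ^ 2 + 256 * V * J * lrVelocity r₀ V J + 1 / 2 + 2 * rateC1 r₀ V J

/-- The constant `K_D = 2 + 2VJ√π` of `1 + ‖D₋‖ ≤ K_D |Λ| L / g`. [folklore] -/
def rateKD : ℝ := 2 + 2 * V * J * Real.sqrt Real.pi

/-- The final constant `400 K_D √K_X`. [folklore] -/
def rateConst : ℝ := 400 * rateKD V J * Real.sqrt (rateKX r₀ V J)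

variable {r₀ V J}

/-- `κ > 0`. [folklore] -/
theorem rateKappa_pos (hJ : 0 ≤ J) (hV : 1 ≤ V) : 0 < rateKappa r₀ V J := by
  have hv := lrVelocity_pos (r₀ := r₀) hJ hV
  unfold rateKappa; positivity

/-- `κ ≤ 1/4`. [folklore] -/
theorem rateKappa_le_quarter : rateKappa r₀ V J ≤ 1 / 4 :=
  (min_le_left _ _).trans (min_le_left _ _)

/-- `κ ≤ 1/(64(r₀+1))`. [folklore] -/
theorem rateKappa_le_lr : rateKappa r₀ V J ≤ 1 / (64 * ((r₀ : ℝ) + 1)) :=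
  (min_le_left _ _).trans (min_le_right _ _)

/-- `κ ≤ 1/(4096 v²)`. [folklore] -/
theorem rateKappa_le_gauss : rateKappa r₀ V J ≤ 1 / (4096 * lrVelocity r₀ V J ^ 2) :=
  (min_le_right _ _).trans (min_le_left _ _)

/-- `κ ≤ 1/(32 v)`. [folklore] -/
theorem rateKappa_le_clust : rateKappa r₀ V J ≤ 1 / (32 * lrVelocity r₀ V J) :=
  (min_le_right _ _).trans (min_le_right _ _)

/-- `C₁' ≥ 2`. [folklore] -/
theorem two_le_rateC1 (hJ : 0 ≤ J) (hV : 1 ≤ V) : 2 ≤ rateC1 r₀ V J := by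
  have hv := lrVelocity_pos (r₀ := r₀) hJ hV
  unfold rateC1
  have : 0 ≤ 8 * ((r₀ : ℝ) + 1) / lrVelocity r₀ V J := by positivity
  nlinarith

/-- `K_X ≥ 1/2`. [folklore] -/
theorem half_le_rateKX (hJ : 0 ≤ J) (hV : 1 ≤ V) : 1 / 2 ≤ rateKX r₀ V J := by
  have hv := lrVelocity_pos (r₀ := r₀) hJ hV
  have h2 := two_le_rateC1 (r₀ := r₀) hJ hV
  unfold rateKX
  have : 0 ≤ 4 * Real.sqrt Real.pi * (V : ℝ) ^ 2 * J ^ 2 := by positivity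
  have : 0 ≤ 256 * (V : ℝ) * J * lrVelocity r₀ V J := by positivity
  linarith

/-- `K_D ≥ 2`. [folklore] -/
theorem two_le_rateKD (hJ : 0 ≤ J) : 2 ≤ rateKD V J := by
  unfold rateKD
  have : 0 ≤ 2 * (V : ℝ) * J * Real.sqrt Real.pi := by positivity
  linarith

end Constants

/-! ### The regime -/

section Regime

variable {Λ : Type*} [Fintype Λ] [DecidableEq Λ] {L : ℕ}
variable {coord : Λ → ZMod L} {f : Λ ≃ Λ} {Φ : Interaction Λ 2} {r₀ V : ℕ} {J : ℝ} {g : ℝ}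
  {ψ : TensorIndex Λ 2 → ℂ}

/-- The arithmetic of the threshold: `L ≥ L₀` gives `L ≥ 64 r₀ + 64` and `16 v ≤ L`. [folklore] -/
theorem regime_basic (hL : rateL0 r₀ V J ≤ L) : 64 * r₀ + 64 ≤ L ∧ 16 * lrVelocity r₀ V J ≤ (L : ℝ) := by
  unfold rateL0 at hL
  refine ⟨by omega, ?_⟩
  have h1 : lrVelocity r₀ V J ≤ ⌈lrVelocity r₀ V J⌉₊ := Nat.le_ceil _
  have h2 : ((64 * (r₀ + 1) + 16 * (⌈lrVelocity r₀ V J⌉₊ + 1) : ℕ) : ℝ) ≤ L := by exact_mod_cast hL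
  push_cast at h2
  nlinarith

/-- `L/32 ≤ R - r₀` with `R = L/16 - r₀ + 1` (as reals), in the regime. [folklore] -/
theorem regime_R (hL : rateL0 r₀ V J ≤ L) :
    (L : ℝ) / 32 ≤ ((L / 16 - r₀ + 1 : ℕ) : ℝ) - r₀ := by
  have h64 := (regime_basic hL).1
  have hnat : L + 64 * r₀ ≤ 32 * (L / 16) + 32 := by omega
  have hreal : ((L + 64 * r₀ : ℕ) : ℝ) ≤ ((32 * (L / 16) + 32 : ℕ) : ℝ) := by exact_mod_cast hnat
  have hsub : ((L / 16 - r₀ + 1 : ℕ) : ℝ) = ((L / 16 : ℕ) : ℝ) - r₀ + 1 := by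
    rw [Nat.cast_add, Nat.cast_sub (by omega)]; push_cast; ring
  push_cast at hreal
  rw [hsub]
  linarith

/-- `L/8 ≤ stripDist - r₀` (as reals), in the regime. [folklore] -/
theorem regime_stripDist (hL : rateL0 r₀ V J ≤ L) :
    (L : ℝ) / 8 ≤ ((stripDist L r₀ (L / 2) (L / 8) : ℕ) : ℝ) - r₀ := by
  have h64 := (regime_basic hL).1
  have hnat : L / 8 + r₀ ≤ stripDist L r₀ (L / 2) (L / 8) := by
    unfold stripDist
    refine le_min ?_ ?_ <;> omega
  have hreal : ((L / 8 + r₀ : ℕ) : ℝ) ≤ ((stripDist L r₀ (L / 2) (L / 8) : ℕ) : ℝ) := by exact_mod_cast hnat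
  have h8 : (L : ℝ) / 8 ≤ ((L / 8 : ℕ) : ℝ) + 1 := by
    have := Nat.lt_div_mul_add (a := L) (b := 8) (by norm_num)
    have h' : ((L : ℕ) : ℝ) < ((L / 8 * 8 + 8 : ℕ) : ℝ) := by exact_mod_cast this
    push_cast at h'
    linarith
  push_cast at hreal
  -- we lose `1`: use `L/8 ≤ (L/8 : ℕ) + 1 ≤ stripDist - r₀ + 1`; tighten with `r₀ ≥ 0`… instead prove the
  -- natural-number statement with one unit of room
  have hnat' : L / 8 + 1 + r₀ ≤ stripDist L r₀ (L / 2) (L / 8) := by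
    unfold stripDist
    refine le_min ?_ ?_ <;> omega
  have hreal' : ((L / 8 + 1 + r₀ : ℕ) : ℝ) ≤ ((stripDist L r₀ (L / 2) (L / 8) : ℕ) : ℝ) := by exact_mod_cast hnat'
  push_cast at hreal'
  linarith

/-- The separation hypothesis of the index theorem holds in the regime. [folklore] -/
theorem regime_sep (hL : rateL0 r₀ V J ≤ L) :
    max (2 * lrVelocity r₀ V J) 1 ≤ ((stripDist L r₀ (L / 2) (L / 8) : ℕ) : ℝ) - r₀ := by
  obtain ⟨h64, hv⟩ := regime_basic hL
  have hSD := regime_stripDist (r₀ := r₀) (V := V) (J := J) hL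
  have hL8 : (8 : ℝ) ≤ (L : ℝ) / 8 := by
    have : (64 : ℝ) ≤ L := by exact_mod_cast (show 64 ≤ L by omega)
    linarith
  refine max_le ?_ ?_ <;> linarith

end Regime

/-! ### The index in the regime: `poly · e^{-κ g L / 2}` -/

section Main

variable {Λ : Type*} [Fintype Λ] [DecidableEq Λ] {L : ℕ} [NeZero L]
variable {coord : Λ → ZMod L} {f : Λ ≃ Λ} {Φ : Interaction Λ 2} {r₀ V : ℕ} {J : ℝ} {g : ℝ}
  {ψ : TensorIndex Λ 2 → ℂ}

omit [NeZero L] in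
/-- `2v ≥ 1` (indeed `v = 2eV(J+1)(r₀+1) ≥ 2e`). [folklore] -/
theorem one_le_two_mul_lrVelocity (hJ : 0 ≤ J) (hV : 1 ≤ V) : (1 : ℝ) ≤ 2 * lrVelocity r₀ V J := by
  unfold lrVelocity
  have he : (1 : ℝ) ≤ Real.exp 1 := Real.one_le_exp (by norm_num)
  have h1 : (1 : ℝ) ≤ V := by exact_mod_cast hV
  have h2 : (1 : ℝ) ≤ J + 1 := by linarith
  have h3 : (1 : ℝ) ≤ (r₀ : ℝ) + 1 := by have := Nat.cast_nonneg (α := ℝ) r₀; linarith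
  calc (1 : ℝ) ≤ 2 * (2 * 1 * 1 * 1 * 1) := by norm_num
    _ ≤ 2 * (2 * Real.exp 1 * V * (J + 1) * (r₀ + 1)) := by gcongr

/-- `√(L/g) ≤ L/g` for `0 < g ≤ 1 ≤ L`. [folklore] -/
theorem sqrt_div_le_div {Lr g : ℝ} (hL : 1 ≤ Lr) (hg : 0 < g) (hg1 : g ≤ 1) : Real.sqrt (Lr / g) ≤ Lr / g := by
  have h1 : 1 ≤ Lr / g := by rw [le_div_iff₀ hg]; linarith
  have h0 : 0 ≤ Lr / g := by linarith
  calc Real.sqrt (Lr / g) ≤ Real.sqrt ((Lr / g) ^ 2) := Real.sqrt_le_sqrt (by nlinarith)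
    _ = Lr / g := Real.sqrt_sq h0

omit [DecidableEq Λ] [NeZero L] in
/-- `#S ≤ |Λ|` as reals. [folklore] -/
theorem card_le_card_univ_real (S : Finset Λ) : (S.card : ℝ) ≤ Fintype.card Λ := by
  exact_mod_cast Finset.card_le_univ S

omit [DecidableEq Λ] [NeZero L] in
/-- **The spectral error in the regime**: `ε_s ≤ |Λ| e^{-κ g L}` (`e^{-g²/(4a)} = e^{-gL/4}` for `a = g/L`).
[folklore] -/
theorem epsSpec_le_of_regime (hg : 0 < g) (hL0 : 0 < L) :
    epsSpec coord (g / L) (L / 2) g ≤ Fintype.card Λ * Real.exp (-(rateKappa r₀ V J * g * L)) := by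
  unfold epsSpec
  have hLpos : (0 : ℝ) < L := by exact_mod_cast hL0
  have hκ := rateKappa_le_quarter (r₀ := r₀) (V := V) (J := J)
  have hexp : Real.exp (-g ^ 2 / (4 * (g / L))) ≤ Real.exp (-(rateKappa r₀ V J * g * L)) := by
    refine Real.exp_le_exp.2 ?_
    have e : -g ^ 2 / (4 * (g / (L : ℝ))) = -(g * L / 4) := by field_simp
    rw [e]
    nlinarith [mul_pos hg hLpos]
  calc Real.exp (-g ^ 2 / (4 * (g / L))) * ((cslab coord (zrange 0 (L / 2))).card : ℝ)
      ≤ Real.exp (-(rateKappa r₀ V J * g * L)) * Fintype.card Λ :=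
        mul_le_mul hexp (card_le_card_univ_real _) (Nat.cast_nonneg _) (Real.exp_nonneg _)
    _ = Fintype.card Λ * Real.exp (-(rateKappa r₀ V J * g * L)) := by ring

/-- **The locality error of one dressed current in the regime** (time cut-off `T = (R - r₀)/(2v)`,
`R = L/16 - r₀ + 1`): `‖K - K̃‖ ≤ e^{-κ g L} (2√π V²J² |Λ|² L²/g + 128 V |Λ| J v/g)`.
[cite: BachmannEtAl2019, Proposition 2.4 (proof)] -/
theorem norm_kLocG_sub_kTildeG_le_of_regime
    (hs : Setting coord f Φ r₀ V J (g / L) (L / 2) (L / 8) (L / 16) g ψ) (hg1 : g ≤ 1)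
    (hL : rateL0 r₀ V J ≤ L) {P B : Finset (ZMod L)} (hPne : (cslab coord P).Nonempty)
    (hsepR : ∀ Z, Φ Z ≠ 0 → ¬ Z ⊆ cslab coord B →
      ∀ z ∈ Z, ∀ p ∈ cslab coord P, L / 16 - r₀ + 1 ≤ circDist (coord z) (coord p)) :
    ‖kLocG (g / L) Φ (cslab coord (zrange 0 (L / 2))) (cslab coord P) (cslab coord B) -
        kTildeG (g / L) Φ (cslab coord (zrange 0 (L / 2))) (cslab coord P)‖ ≤
      Real.exp (-(rateKappa r₀ V J * g * L)) *
        (2 * Real.sqrt Real.pi * (V : ℝ) ^ 2 * J ^ 2 * (Fintype.card Λ : ℝ) ^ 2 * (L : ℝ) ^ 2 / g +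
          128 * V * Fintype.card Λ * J * lrVelocity r₀ V J / g) := by
  obtain ⟨h64, -⟩ := regime_basic hL
  have hg : 0 < g := hs.gap_pos
  have hJ : 0 ≤ J := hs.coordLocal.strength_nonneg
  have hV1n : 1 ≤ V := hs.coordLocal.one_le_size
  have hv := lrVelocity_pos (r₀ := r₀) hJ hV1n
  have h2v := one_le_two_mul_lrVelocity (r₀ := r₀) hJ hV1n
  have hL64 : (64 : ℝ) ≤ L := by exact_mod_cast (show 64 ≤ L by omega)
  have hLpos : (0 : ℝ) < L := by linarith
  have hN1 : (1 : ℝ) ≤ Fintype.card Λ := by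
    obtain ⟨x, -⟩ := hs.surj 0
    exact_mod_cast Fintype.card_pos_iff.2 ⟨x⟩
  have ha : (0 : ℝ) < g / L := div_pos hg hLpos
  have hρR : (L : ℝ) / 32 ≤ ((L / 16 - r₀ + 1 : ℕ) : ℝ) - r₀ := regime_R (r₀ := r₀) (V := V) (J := J) hL
  have hρR0 : 0 < ((L / 16 - r₀ + 1 : ℕ) : ℝ) - r₀ := by linarith
  have hρRL : ((L / 16 - r₀ + 1 : ℕ) : ℝ) - r₀ ≤ L := by
    have : ((L / 16 - r₀ + 1 : ℕ) : ℝ) ≤ L := by exact_mod_cast (show L / 16 - r₀ + 1 ≤ L by omega)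
    linarith [Nat.cast_nonneg (α := ℝ) r₀]
  -- the time cut-off
  have hT : 0 < (((L / 16 - r₀ + 1 : ℕ) : ℝ) - r₀) / (2 * lrVelocity r₀ V J) := by positivity
  have hT_le : (((L / 16 - r₀ + 1 : ℕ) : ℝ) - r₀) / (2 * lrVelocity r₀ V J) ≤ L := by
    rw [div_le_iff₀ (by positivity)]; nlinarith
  have hloc := norm_kLocG_sub_kTildeG_le hs.coordLocal ha (S := cslab coord (zrange 0 (L / 2))) hPne hsepR hT
  refine hloc.trans ?_
  -- the three analytic factors
  have hexpLR : Real.exp (-((((L / 16 - r₀ + 1 : ℕ) : ℝ) - r₀) / (r₀ + 1)) +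
      lrVelocity r₀ V J / (r₀ + 1) * ((((L / 16 - r₀ + 1 : ℕ) : ℝ) - r₀) / (2 * lrVelocity r₀ V J))) ≤
      Real.exp (-(rateKappa r₀ V J * g * L)) := by
    have e : -((((L / 16 - r₀ + 1 : ℕ) : ℝ) - r₀) / (r₀ + 1)) +
        lrVelocity r₀ V J / (r₀ + 1) * ((((L / 16 - r₀ + 1 : ℕ) : ℝ) - r₀) / (2 * lrVelocity r₀ V J)) =
        -((((L / 16 - r₀ + 1 : ℕ) : ℝ) - r₀) / (2 * ((r₀ : ℝ) + 1))) := by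
      field_simp; ring
    rw [e]
    refine Real.exp_le_exp.2 ?_
    have hκ := rateKappa_le_lr (r₀ := r₀) (V := V) (J := J)
    have hr : (0 : ℝ) < (r₀ : ℝ) + 1 := by positivity
    have h1 : rateKappa r₀ V J * g * L ≤ (L : ℝ) / (64 * ((r₀ : ℝ) + 1)) := by
      calc rateKappa r₀ V J * g * L ≤ 1 / (64 * ((r₀ : ℝ) + 1)) * 1 * L := by gcongr
        _ = (L : ℝ) / (64 * ((r₀ : ℝ) + 1)) := by ring
    have h2 : (L : ℝ) / (64 * ((r₀ : ℝ) + 1)) ≤ (((L / 16 - r₀ + 1 : ℕ) : ℝ) - r₀) / (2 * ((r₀ : ℝ) + 1)) := by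
      rw [div_le_div_iff₀ (by positivity) (by positivity)]; nlinarith
    linarith
  have hexpG : Real.exp (-(g / L) * ((((L / 16 - r₀ + 1 : ℕ) : ℝ) - r₀) / (2 * lrVelocity r₀ V J)) ^ 2) ≤
      Real.exp (-(rateKappa r₀ V J * g * L)) := by
    refine Real.exp_le_exp.2 ?_
    have hκ := rateKappa_le_gauss (r₀ := r₀) (V := V) (J := J)
    have h1 : rateKappa r₀ V J * g * L ≤ g * L / (4096 * lrVelocity r₀ V J ^ 2) := by
      calc rateKappa r₀ V J * g * L = rateKappa r₀ V J * (g * L) := by ring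
        _ ≤ 1 / (4096 * lrVelocity r₀ V J ^ 2) * (g * L) := by gcongr
        _ = g * L / (4096 * lrVelocity r₀ V J ^ 2) := by ring
    have h2 : g * L / (4096 * lrVelocity r₀ V J ^ 2) ≤
        g / (L : ℝ) * ((((L / 16 - r₀ + 1 : ℕ) : ℝ) - r₀) / (2 * lrVelocity r₀ V J)) ^ 2 := by
      have e : g / (L : ℝ) * ((((L / 16 - r₀ + 1 : ℕ) : ℝ) - r₀) / (2 * lrVelocity r₀ V J)) ^ 2 =
          g * (((L / 16 - r₀ + 1 : ℕ) : ℝ) - r₀) ^ 2 / ((L : ℝ) * (4 * lrVelocity r₀ V J ^ 2)) := by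
        field_simp
        ring
      rw [e, div_le_div_iff₀ (by positivity) (by positivity)]
      have h3 : (L : ℝ) ^ 2 ≤ (32 * ((((L / 16 - r₀ + 1 : ℕ) : ℝ) - r₀))) ^ 2 := pow_le_pow_left₀ hLpos.le (by linarith) 2
      have h4 := mul_le_mul_of_nonneg_left h3 (by positivity : (0 : ℝ) ≤ 4 * g * lrVelocity r₀ V J ^ 2)
      nlinarith [h4]
    linarith
  have hinv : 1 / (2 * (g / L) * ((((L / 16 - r₀ + 1 : ℕ) : ℝ) - r₀) / (2 * lrVelocity r₀ V J))) ≤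
      32 * lrVelocity r₀ V J / g := by
    rw [div_le_div_iff₀ (by positivity) hg]
    have e : 32 * lrVelocity r₀ V J * (2 * (g / (L : ℝ)) * ((((L / 16 - r₀ + 1 : ℕ) : ℝ) - r₀) / (2 * lrVelocity r₀ V J))) =
        g * (32 * ((((L / 16 - r₀ + 1 : ℕ) : ℝ) - r₀)) / L) := by field_simp
    rw [e, one_mul]
    have : (1 : ℝ) ≤ 32 * ((((L / 16 - r₀ + 1 : ℕ) : ℝ) - r₀)) / L := by
      rw [le_div_iff₀ hLpos]; linarith
    nlinarith
  have hsqrt : Real.sqrt (Real.pi / (g / L)) / 2 ≤ Real.sqrt Real.pi * L / (2 * g) := by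
    have e : Real.pi / (g / (L : ℝ)) = Real.pi * (L / g) := by field_simp
    rw [e, Real.sqrt_mul Real.pi_pos.le]
    have := sqrt_div_le_div (Lr := (L : ℝ)) (by linarith) hg hg1
    have hπ := Real.sqrt_nonneg Real.pi
    calc Real.sqrt Real.pi * Real.sqrt ((L : ℝ) / g) / 2 ≤ Real.sqrt Real.pi * ((L : ℝ) / g) / 2 := by gcongr
      _ = Real.sqrt Real.pi * L / (2 * g) := by field_simp
  -- the window current
  have hJc0 := norm_nonneg (windowCurrent Φ (cslab coord (zrange 0 (L / 2))) (cslab coord P))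
  have hJc : ‖windowCurrent Φ (cslab coord (zrange 0 (L / 2))) (cslab coord P)‖ ≤ 2 * V * (Fintype.card Λ * J) :=
    (norm_windowCurrent_le hs.coordLocal.isLocal hs.coordLocal.size hs.coordLocal.strength _ _).trans
      (mul_le_mul_of_nonneg_left (mul_le_mul_of_nonneg_right (card_le_card_univ_real _) hJ) (by positivity))
  -- the two terms
  have hω0 := Real.exp_pos (-(rateKappa r₀ V J * g * L))
  have t1 : Fintype.card Λ * J * (2 * V * ‖windowCurrent Φ (cslab coord (zrange 0 (L / 2))) (cslab coord P)‖ *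
        Real.exp (-((((L / 16 - r₀ + 1 : ℕ) : ℝ) - r₀) / (r₀ + 1)) +
          lrVelocity r₀ V J / (r₀ + 1) * ((((L / 16 - r₀ + 1 : ℕ) : ℝ) - r₀) / (2 * lrVelocity r₀ V J)))) *
        ((((L / 16 - r₀ + 1 : ℕ) : ℝ) - r₀) / (2 * lrVelocity r₀ V J)) * (Real.sqrt (Real.pi / (g / L)) / 2) ≤
      Real.exp (-(rateKappa r₀ V J * g * L)) *
        (2 * Real.sqrt Real.pi * (V : ℝ) ^ 2 * J ^ 2 * (Fintype.card Λ : ℝ) ^ 2 * (L : ℝ) ^ 2 / g) := by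
    calc Fintype.card Λ * J * (2 * V * ‖windowCurrent Φ (cslab coord (zrange 0 (L / 2))) (cslab coord P)‖ *
          Real.exp (-((((L / 16 - r₀ + 1 : ℕ) : ℝ) - r₀) / (r₀ + 1)) +
            lrVelocity r₀ V J / (r₀ + 1) * ((((L / 16 - r₀ + 1 : ℕ) : ℝ) - r₀) / (2 * lrVelocity r₀ V J)))) *
          ((((L / 16 - r₀ + 1 : ℕ) : ℝ) - r₀) / (2 * lrVelocity r₀ V J)) * (Real.sqrt (Real.pi / (g / L)) / 2)
        ≤ Fintype.card Λ * J * (2 * V * (2 * V * (Fintype.card Λ * J)) * Real.exp (-(rateKappa r₀ V J * g * L))) *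
          L * (Real.sqrt Real.pi * L / (2 * g)) := by gcongr
      _ = Real.exp (-(rateKappa r₀ V J * g * L)) *
          (2 * Real.sqrt Real.pi * (V : ℝ) ^ 2 * J ^ 2 * (Fintype.card Λ : ℝ) ^ 2 * (L : ℝ) ^ 2 / g) := by
          ring
  have t2 : 2 * ‖windowCurrent Φ (cslab coord (zrange 0 (L / 2))) (cslab coord P)‖ *
        (Real.exp (-(g / L) * ((((L / 16 - r₀ + 1 : ℕ) : ℝ) - r₀) / (2 * lrVelocity r₀ V J)) ^ 2) /
          (2 * (g / L) * ((((L / 16 - r₀ + 1 : ℕ) : ℝ) - r₀) / (2 * lrVelocity r₀ V J)))) ≤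
      Real.exp (-(rateKappa r₀ V J * g * L)) * (128 * V * Fintype.card Λ * J * lrVelocity r₀ V J / g) := by
    rw [div_eq_mul_one_div (Real.exp _)]
    calc 2 * ‖windowCurrent Φ (cslab coord (zrange 0 (L / 2))) (cslab coord P)‖ *
          (Real.exp (-(g / L) * ((((L / 16 - r₀ + 1 : ℕ) : ℝ) - r₀) / (2 * lrVelocity r₀ V J)) ^ 2) *
            (1 / (2 * (g / L) * ((((L / 16 - r₀ + 1 : ℕ) : ℝ) - r₀) / (2 * lrVelocity r₀ V J)))))
        ≤ 2 * (2 * V * (Fintype.card Λ * J)) * (Real.exp (-(rateKappa r₀ V J * g * L)) * (32 * lrVelocity r₀ V J / g)) := by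
          gcongr
      _ = Real.exp (-(rateKappa r₀ V J * g * L)) * (128 * V * Fintype.card Λ * J * lrVelocity r₀ V J / g) := by ring
  linarith

/-- **`δ_K` in the regime**: `δ_K ≤ e^{-κgL}(4√π V²J²|Λ|²L²/g + 256 V|Λ|Jv/g)`. [folklore] -/
theorem deltaK_le_of_regime (hs : Setting coord f Φ r₀ V J (g / L) (L / 2) (L / 8) (L / 16) g ψ)
    (hg1 : g ≤ 1) (hL : rateL0 r₀ V J ≤ L) :
    deltaK coord Φ r₀ (g / L) (L / 2) (L / 16) ≤
      Real.exp (-(rateKappa r₀ V J * g * L)) *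
        (4 * Real.sqrt Real.pi * (V : ℝ) ^ 2 * J ^ 2 * (Fintype.card Λ : ℝ) ^ 2 * (L : ℝ) ^ 2 / g +
          256 * V * Fintype.card Λ * J * lrVelocity r₀ V J / g) := by
  have h1 := norm_kLocG_sub_kTildeG_le_of_regime hs hg1 hL (cslab_winM_nonempty hs) (ballM_separation hs)
  have h2 := norm_kLocG_sub_kTildeG_le_of_regime hs hg1 hL (cslab_winP_nonempty hs) (ballP_separation hs)
  unfold deltaK kM kP kTM kTP
  refine (add_le_add h1 h2).trans (le_of_eq ?_)
  ring

omit [NeZero L] in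
/-- **The strip clustering constant in the regime**: `clustK ≤ e^{-κgL} · 2C₁'|Λ|/g`. [folklore] -/
theorem clustK_le_of_regime (hs : Setting coord f Φ r₀ V J (g / L) (L / 2) (L / 8) (L / 16) g ψ)
    (hg1 : g ≤ 1) (hL : rateL0 r₀ V J ≤ L) :
    clustK coord r₀ V J (L / 2) (L / 8) g ≤
      Real.exp (-(rateKappa r₀ V J * g * L)) * (2 * rateC1 r₀ V J * Fintype.card Λ / g) := by
  obtain ⟨h64, -⟩ := regime_basic hL
  have hg : 0 < g := hs.gap_pos
  have hJ : 0 ≤ J := hs.coordLocal.strength_nonneg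
  have hV1n : 1 ≤ V := hs.coordLocal.one_le_size
  have hv := lrVelocity_pos (r₀ := r₀) hJ hV1n
  have hL64 : (64 : ℝ) ≤ L := by exact_mod_cast (show 64 ≤ L by omega)
  have hLpos : (0 : ℝ) < L := by linarith
  have hSD := regime_stripDist (r₀ := r₀) (V := V) (J := J) hL
  have hC10 : 0 ≤ rateC1 r₀ V J := by linarith [two_le_rateC1 (r₀ := r₀) hJ hV1n]
  unfold clustK
  -- prefactor
  have hC1 : 2 + 4 * J + 4 * 2 / (lrVelocity r₀ V J * (1 / ((r₀ : ℝ) + 1))) + 8 * lrVelocity r₀ V J / g ≤ rateC1 r₀ V J / g := by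
    unfold rateC1
    have e : 4 * 2 / (lrVelocity r₀ V J * (1 / ((r₀ : ℝ) + 1))) = 8 * ((r₀ : ℝ) + 1) / lrVelocity r₀ V J := by
      field_simp; ring
    rw [e, le_div_iff₀ hg, add_mul, div_mul_cancel₀ _ hg.ne']
    have t0 : 0 ≤ 2 + 4 * J + 8 * ((r₀ : ℝ) + 1) / lrVelocity r₀ V J := by positivity
    nlinarith [mul_nonneg t0 (sub_nonneg.2 hg1)]
  have hpref0 : 0 ≤ 2 + 4 * J + 4 * 2 / (lrVelocity r₀ V J * (1 / ((r₀ : ℝ) + 1))) + 8 * lrVelocity r₀ V J / g := by positivity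
  have hmax : ((max (cslab coord (stripM r₀ (L / 8))).card (cslab coord (stripP r₀ (L / 2) (L / 8))).card : ℕ) : ℝ) ≤
      Fintype.card Λ := by
    exact_mod_cast max_le (Finset.card_le_univ _) (Finset.card_le_univ _)
  -- exponential
  have hexp : Real.exp (-(((stripDist L r₀ (L / 2) (L / 8) : ℕ) : ℝ) - (r₀ : ℝ)) /
        max (8 / (1 / ((r₀ : ℝ) + 1))) (4 * lrVelocity r₀ V J / g)) ≤ 2 * Real.exp (-(rateKappa r₀ V J * g * L)) := by
    have hA : (0 : ℝ) < 8 / (1 / ((r₀ : ℝ) + 1)) := by positivity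
    have hM : 0 < max (8 / (1 / ((r₀ : ℝ) + 1))) (4 * lrVelocity r₀ V J / g) := lt_max_of_lt_left hA
    have hκ1 := rateKappa_le_lr (r₀ := r₀) (V := V) (J := J)
    have hκ2 := rateKappa_le_clust (r₀ := r₀) (V := V) (J := J)
    have hκ0 := (rateKappa_pos (r₀ := r₀) hJ hV1n).le
    calc Real.exp (-(((stripDist L r₀ (L / 2) (L / 8) : ℕ) : ℝ) - (r₀ : ℝ)) / max (8 / (1 / ((r₀ : ℝ) + 1))) (4 * lrVelocity r₀ V J / g))
        ≤ Real.exp (-((L : ℝ) / 8) / max (8 / (1 / ((r₀ : ℝ) + 1))) (4 * lrVelocity r₀ V J / g)) := by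
          refine Real.exp_le_exp.2 ?_
          rw [neg_div, neg_div, neg_le_neg_iff, div_le_div_iff_of_pos_right hM]
          exact hSD
      _ ≤ Real.exp (-((L : ℝ) / 8) / (8 / (1 / ((r₀ : ℝ) + 1)))) + Real.exp (-((L : ℝ) / 8) / (4 * lrVelocity r₀ V J / g)) :=
          exp_neg_div_max_le _ _ _
      _ ≤ Real.exp (-(rateKappa r₀ V J * g * L)) + Real.exp (-(rateKappa r₀ V J * g * L)) := by
          refine add_le_add (Real.exp_le_exp.2 ?_) (Real.exp_le_exp.2 ?_)
          · have e : -((L : ℝ) / 8) / (8 / (1 / ((r₀ : ℝ) + 1))) = -((L : ℝ) / (64 * ((r₀ : ℝ) + 1))) := by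
              field_simp; ring
            rw [e, neg_le_neg_iff]
            calc rateKappa r₀ V J * g * L ≤ 1 / (64 * ((r₀ : ℝ) + 1)) * 1 * L := by gcongr
              _ = (L : ℝ) / (64 * ((r₀ : ℝ) + 1)) := by ring
          · have e : -((L : ℝ) / 8) / (4 * lrVelocity r₀ V J / g) = -(g * L / (32 * lrVelocity r₀ V J)) := by
              field_simp; norm_num
            rw [e, neg_le_neg_iff]
            calc rateKappa r₀ V J * g * L = rateKappa r₀ V J * (g * L) := by ring
              _ ≤ 1 / (32 * lrVelocity r₀ V J) * (g * L) := by gcongr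
              _ = g * L / (32 * lrVelocity r₀ V J) := by ring
      _ = 2 * Real.exp (-(rateKappa r₀ V J * g * L)) := by ring
  calc (2 + 4 * J + 4 * 2 / (lrVelocity r₀ V J * (1 / ((r₀ : ℝ) + 1))) + 8 * lrVelocity r₀ V J / g) *
        ((max (cslab coord (stripM r₀ (L / 8))).card (cslab coord (stripP r₀ (L / 2) (L / 8))).card : ℕ) : ℝ) *
        Real.exp (-(((stripDist L r₀ (L / 2) (L / 8) : ℕ) : ℝ) - (r₀ : ℝ)) / max (8 / (1 / ((r₀ : ℝ) + 1))) (4 * lrVelocity r₀ V J / g))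
      ≤ (rateC1 r₀ V J / g) * Fintype.card Λ * (2 * Real.exp (-(rateKappa r₀ V J * g * L))) :=
        mul_le_mul (mul_le_mul hC1 hmax (Nat.cast_nonneg _) (div_nonneg hC10 hg.le)) hexp (Real.exp_nonneg _)
          (mul_nonneg (div_nonneg hC10 hg.le) (Nat.cast_nonneg _))
    _ = Real.exp (-(rateKappa r₀ V J * g * L)) * (2 * rateC1 r₀ V J * Fintype.card Λ / g) := by ring

omit [NeZero L] in
/-- **`1 + ‖D₋‖` in the regime**: `1 + ‖Q̄₋^U - Q̄₋‖ ≤ K_D |Λ| L / g`. [folklore] -/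
theorem one_add_norm_dM_le_of_regime (hs : Setting coord f Φ r₀ V J (g / L) (L / 2) (L / 8) (L / 16) g ψ)
    (hg1 : g ≤ 1) (hL : rateL0 r₀ V J ≤ L) :
    1 + ‖qBarMU coord f Φ r₀ (g / L) (L / 2) (L / 8) (L / 16) - qBarM coord Φ r₀ (g / L) (L / 2) (L / 8) (L / 16)‖ ≤
      rateKD V J * Fintype.card Λ * L / g := by
  obtain ⟨h64, -⟩ := regime_basic hL
  have hg : 0 < g := hs.gap_pos
  have hJ : 0 ≤ J := hs.coordLocal.strength_nonneg
  have hL64 : (64 : ℝ) ≤ L := by exact_mod_cast (show 64 ≤ L by omega)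
  have hLpos : (0 : ℝ) < L := by linarith
  have hN1 : (1 : ℝ) ≤ Fintype.card Λ := by
    obtain ⟨x, -⟩ := hs.surj 0
    exact_mod_cast Fintype.card_pos_iff.2 ⟨x⟩
  have h1 := norm_dM_le hs
  have hsqrt : Real.sqrt (Real.pi / (g / L)) / 2 ≤ Real.sqrt Real.pi * L / (2 * g) := by
    have e : Real.pi / (g / (L : ℝ)) = Real.pi * (L / g) := by field_simp
    rw [e, Real.sqrt_mul Real.pi_pos.le]
    have := sqrt_div_le_div (Lr := (L : ℝ)) (by linarith) hg hg1
    have hπ := Real.sqrt_nonneg Real.pi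
    calc Real.sqrt Real.pi * Real.sqrt ((L : ℝ) / g) / 2 ≤ Real.sqrt Real.pi * ((L : ℝ) / g) / 2 := by gcongr
      _ = Real.sqrt Real.pi * L / (2 * g) := by field_simp
  have h3 : ‖kM coord Φ r₀ (g / L) (L / 2) (L / 16)‖ ≤ Real.sqrt Real.pi * L / (2 * g) * (2 * V * (Fintype.card Λ * J)) :=
    (norm_kM_le hs).trans (mul_le_mul hsqrt
      (mul_le_mul_of_nonneg_left (mul_le_mul_of_nonneg_right (card_le_card_univ_real _) hJ) (by positivity))
      (by positivity) (by positivity))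
  have h4 := card_le_card_univ_real (cslab coord (zrange 0 1))
  have hg' : (1 : ℝ) ≤ L / g := by rw [le_div_iff₀ hg]; linarith
  have hNL : (Fintype.card Λ : ℝ) ≤ Fintype.card Λ * (L / g) := le_mul_of_one_le_right (by linarith) hg'
  unfold rateKD
  have e : (2 + 2 * (V : ℝ) * J * Real.sqrt Real.pi) * Fintype.card Λ * L / g =
      Fintype.card Λ * (L / g) + Fintype.card Λ * (L / g) + 2 * (Real.sqrt Real.pi * L / (2 * g) * (2 * V * (Fintype.card Λ * J))) := by
    field_simp; ring
  rw [e]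
  linarith [le_trans hN1 hNL]

omit [Fintype Λ] [DecidableEq Λ] [NeZero L] in
/-- `√X ≤ √K N L √ω / g` when `X ≤ K N² L² ω / g` (`0 < g ≤ 1`). [folklore] -/
theorem sqrt_le_of_le_bound {X K N Lr ω g : ℝ} (hK : 0 ≤ K) (hω : 0 ≤ ω) (hg : 0 < g) (hg1 : g ≤ 1)
    (hN : 0 ≤ N) (hLr : 0 ≤ Lr) (hX : X ≤ K * N ^ 2 * Lr ^ 2 * ω / g) :
    Real.sqrt X ≤ Real.sqrt K * N * Lr * Real.sqrt ω / g := by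
  have hY0 : 0 ≤ Real.sqrt K * N * Lr * Real.sqrt ω / g := by positivity
  have hsq : X ≤ (Real.sqrt K * N * Lr * Real.sqrt ω / g) ^ 2 := by
    have e : (Real.sqrt K * N * Lr * Real.sqrt ω / g) ^ 2 = K * N ^ 2 * Lr ^ 2 * ω / g ^ 2 := by
      rw [div_pow, mul_pow, mul_pow, mul_pow, Real.sq_sqrt hK, Real.sq_sqrt hω]
    rw [e]
    refine hX.trans ?_
    rw [div_le_div_iff₀ hg (by positivity)]
    have : g ^ 2 ≤ g := by nlinarith
    have h0 : 0 ≤ K * N ^ 2 * Lr ^ 2 * ω := by positivity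
    nlinarith
  exact (Real.sqrt_le_sqrt hsq).trans (le_of_eq (Real.sqrt_sq hY0))

omit [Fintype Λ] [DecidableEq Λ] [NeZero L] in
/-- If `1 < K N² L² ω / g` then `1 < √K N L √ω / g` (`0 < g ≤ 1`). [folklore] -/
theorem one_lt_of_bound_gt {K N Lr ω g : ℝ} (hK : 0 ≤ K) (hω : 0 ≤ ω) (hg : 0 < g) (hg1 : g ≤ 1)
    (hN : 0 ≤ N) (hLr : 0 ≤ Lr) (h1 : 1 < K * N ^ 2 * Lr ^ 2 * ω / g) :
    1 < Real.sqrt K * N * Lr * Real.sqrt ω / g := by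
  have hY0 : 0 ≤ Real.sqrt K * N * Lr * Real.sqrt ω / g := by positivity
  by_contra hle
  rw [not_lt] at hle
  have hsq := pow_le_pow_left₀ hY0 hle 2
  rw [one_pow, div_pow, mul_pow, mul_pow, mul_pow, Real.sq_sqrt hK, Real.sq_sqrt hω] at hsq
  have : K * N ^ 2 * Lr ^ 2 * ω / g ≤ K * N ^ 2 * Lr ^ 2 * ω / g ^ 2 := by
    rw [div_le_div_iff₀ hg (by positivity)]
    have : g ^ 2 ≤ g := by nlinarith
    have h0 : 0 ≤ K * N ^ 2 * Lr ^ 2 * ω := by positivity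
    nlinarith
  linarith

omit [Fintype Λ] [DecidableEq Λ] [NeZero L] in
/-- `1/2 ≤ 400 D Y` for `D ≥ 2`, `Y > 1`. [folklore] -/
theorem half_le_bound {D Y : ℝ} (hD : 2 ≤ D) (hY : 1 < Y) : 1 / 2 ≤ 400 * D * Y := by
  nlinarith

omit [Fintype Λ] [DecidableEq Λ] [NeZero L] in
/-- `X + √X ≤ 2√X` for `0 ≤ X ≤ 1`. [folklore] -/
theorem add_sqrt_le_two_sqrt {X : ℝ} (hX0 : 0 ≤ X) (hX1 : X ≤ 1) : X + Real.sqrt X ≤ 2 * Real.sqrt X := by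
  have : X ≤ Real.sqrt X := by
    calc X = Real.sqrt X * Real.sqrt X := (Real.mul_self_sqrt hX0).symm
      _ ≤ Real.sqrt X * 1 := by
          refine mul_le_mul_of_nonneg_left ?_ (Real.sqrt_nonneg _)
          rw [show (1:ℝ) = Real.sqrt 1 from Real.sqrt_one.symm]; exact Real.sqrt_le_sqrt hX1
      _ = Real.sqrt X := mul_one _
  linarith

/-- **The Lieb–Schultz–Mattis index in the regime** (BBDF Thm 2.1 + Prop 2.4 with the Gaussian
dressing at rate `a = g/L`, scales `h = L/2`, `m = L/8`, `r = L/16`, `L ≥ rateL0`, `0 < g ≤ 1`): the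
ground-state charge of one coordinate plane `ρ₀ = ⟨ψ, Q_{slab [0]} ψ⟩` is within
`rateConst · |Λ|² L² g⁻² · e^{-κ g L/2}` of an integer, `κ = rateKappa r₀ V J`. All constants depend
on `(r₀, V, J)` only. [cite: BachmannEtAl2019, Theorem 2.1, Proposition 2.4 and §3.2] -/
theorem exists_int_abs_sub_le_of_regime
    (hs : Setting coord f Φ r₀ V J (g / L) (L / 2) (L / 8) (L / 16) g ψ) (hg1 : g ≤ 1)
    (hL : rateL0 r₀ V J ≤ L) :
    ∃ n : ℤ, |(star ψ ⬝ᵥ (regionCharge (cslab coord (zrange 0 1)) *ᵥ ψ)).re - n| ≤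
      rateConst r₀ V J * (Fintype.card Λ : ℝ) ^ 2 * (L : ℝ) ^ 2 / g ^ 2 *
        Real.exp (-(rateKappa r₀ V J * g * L / 2)) := by
  obtain ⟨h64, -⟩ := regime_basic hL
  have hg : 0 < g := hs.gap_pos
  have hJ : 0 ≤ J := hs.coordLocal.strength_nonneg
  have hV1n : 1 ≤ V := hs.coordLocal.one_le_size
  have hv := lrVelocity_pos (r₀ := r₀) hJ hV1n
  have hL64 : (64 : ℝ) ≤ L := by exact_mod_cast (show 64 ≤ L by omega)
  have hLpos : (0 : ℝ) < L := by linarith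
  have hN1 : (1 : ℝ) ≤ Fintype.card Λ := by
    obtain ⟨x, -⟩ := hs.surj 0
    exact_mod_cast Fintype.card_pos_iff.2 ⟨x⟩
  have hNpos : (0 : ℝ) < Fintype.card Λ := by linarith
  have hω0 := Real.exp_pos (-(rateKappa r₀ V J * g * L))
  have hKX := half_le_rateKX (r₀ := r₀) hJ hV1n
  have hKX0 : 0 < rateKX r₀ V J := by linarith
  have hKD := two_le_rateKD (V := V) hJ
  have hC10 : 0 ≤ rateC1 r₀ V J := by linarith [two_le_rateC1 (r₀ := r₀) hJ hV1n]
  -- the pieces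
  have hεs := epsSpec_le_of_regime (coord := coord) (r₀ := r₀) (V := V) (J := J) hg (show 0 < L by omega)
  have hδK := deltaK_le_of_regime hs hg1 hL
  have hCK := clustK_le_of_regime hs hg1 hL
  have hD := one_add_norm_dM_le_of_regime hs hg1 hL
  have hδK0 := deltaK_nonneg coord Φ r₀ (g / L) (L / 2) (L / 16)
  have hεs0 := epsSpec_nonneg coord (g / L) (L / 2) g
  have hCK0 := clustK_nonneg hs
  -- names for the reals
  set ω : ℝ := Real.exp (-(rateKappa r₀ V J * g * L)) with hωdef
  set N : ℝ := (Fintype.card Λ : ℝ) with hNdef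
  set M : ℝ := N ^ 2 * (L : ℝ) ^ 2 / g with hMdef
  set X : ℝ := (deltaK coord Φ r₀ (g / L) (L / 2) (L / 16) + epsSpec coord (g / L) (L / 2) g / 2) +
    clustK coord r₀ V J (L / 2) (L / 8) g with hXdef
  have hX0 : 0 ≤ X := by positivity
  have hM0 : 0 ≤ M := by positivity
  -- `X ≤ K_X N² L² ω / g`
  have hNg : N / g ≤ M := by
    rw [hMdef, div_le_div_iff_of_pos_right hg]
    nlinarith [mul_le_mul hN1 (show (1:ℝ) ≤ (L:ℝ) ^ 2 by nlinarith) zero_le_one hNpos.le]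
  have hN2 : N / 2 ≤ 1 / 2 * M := by
    have : N ≤ M := le_trans (by rw [le_div_iff₀ hg]; nlinarith) hNg
    linarith
  have hXb : X ≤ rateKX r₀ V J * N ^ 2 * (L : ℝ) ^ 2 * ω / g := by
    have step1 : X ≤ ω * (4 * Real.sqrt Real.pi * (V : ℝ) ^ 2 * J ^ 2 * N ^ 2 * (L : ℝ) ^ 2 / g +
        256 * V * N * J * lrVelocity r₀ V J / g) + N * ω / 2 + ω * (2 * rateC1 r₀ V J * N / g) := by
      rw [hXdef]; linarith
    have hA : 4 * Real.sqrt Real.pi * (V : ℝ) ^ 2 * J ^ 2 * N ^ 2 * (L : ℝ) ^ 2 / g = 4 * Real.sqrt Real.pi * (V : ℝ) ^ 2 * J ^ 2 * M := by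
      rw [hMdef]; ring
    have a1 : 256 * (V : ℝ) * N * J * lrVelocity r₀ V J / g ≤ 256 * V * J * lrVelocity r₀ V J * M := by
      calc 256 * (V : ℝ) * N * J * lrVelocity r₀ V J / g = 256 * V * J * lrVelocity r₀ V J * (N / g) := by ring
        _ ≤ 256 * V * J * lrVelocity r₀ V J * M := by gcongr
    have a2 : 2 * rateC1 r₀ V J * N / g ≤ 2 * rateC1 r₀ V J * M := by
      calc 2 * rateC1 r₀ V J * N / g = 2 * rateC1 r₀ V J * (N / g) := by ring
        _ ≤ 2 * rateC1 r₀ V J * M := by gcongr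
    have step2 : 4 * Real.sqrt Real.pi * (V : ℝ) ^ 2 * J ^ 2 * N ^ 2 * (L : ℝ) ^ 2 / g +
        256 * V * N * J * lrVelocity r₀ V J / g + N / 2 + 2 * rateC1 r₀ V J * N / g ≤
        (4 * Real.sqrt Real.pi * (V : ℝ) ^ 2 * J ^ 2 + 256 * V * J * lrVelocity r₀ V J + 1 / 2 + 2 * rateC1 r₀ V J) * M := by
      nlinarith
    calc X ≤ ω * (4 * Real.sqrt Real.pi * (V : ℝ) ^ 2 * J ^ 2 * N ^ 2 * (L : ℝ) ^ 2 / g +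
          256 * V * N * J * lrVelocity r₀ V J / g) + N * ω / 2 + ω * (2 * rateC1 r₀ V J * N / g) := step1
      _ = ω * (4 * Real.sqrt Real.pi * (V : ℝ) ^ 2 * J ^ 2 * N ^ 2 * (L : ℝ) ^ 2 / g +
          256 * V * N * J * lrVelocity r₀ V J / g + N / 2 + 2 * rateC1 r₀ V J * N / g) := by ring
      _ ≤ ω * ((4 * Real.sqrt Real.pi * (V : ℝ) ^ 2 * J ^ 2 + 256 * V * J * lrVelocity r₀ V J + 1 / 2 + 2 * rateC1 r₀ V J) * M) :=
          mul_le_mul_of_nonneg_left step2 hω0.le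
      _ = rateKX r₀ V J * N ^ 2 * (L : ℝ) ^ 2 * ω / g := by rw [hMdef, rateKX]; ring
  -- the index theorem
  have hsep := regime_sep (r₀ := r₀) (V := V) (J := J) hL
  have hsqrtω : Real.sqrt ω = Real.exp (-(rateKappa r₀ V J * g * L / 2)) := by
    rw [hωdef, ← Real.exp_half]; congr 1; ring
  have hsqX : Real.sqrt X ≤ Real.sqrt (rateKX r₀ V J) * N * L * Real.sqrt ω / g :=
    sqrt_le_of_le_bound hKX0.le hω0.le hg hg1 hNpos.le hLpos.le hXb
  have hBd_eq : rateConst r₀ V J * N ^ 2 * (L : ℝ) ^ 2 / g ^ 2 * Real.exp (-(rateKappa r₀ V J * g * L / 2)) =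
      400 * (rateKD V J * N * L / g) * (Real.sqrt (rateKX r₀ V J) * N * L * Real.sqrt ω / g) := by
    rw [rateConst, ← hsqrtω]; ring
  rw [hBd_eq]
  by_cases hX1 : X ≤ 1
  · obtain ⟨n, hn⟩ := exists_int_abs_expect_plane_sub_le hs hsep
    refine ⟨n, hn.trans ?_⟩
    have hshape := errShape_le (δ := deltaK coord Φ r₀ (g / L) (L / 2) (L / 16) + epsSpec coord (g / L) (L / 2) g / 2)
      (C := clustK coord r₀ V J (L / 2) (L / 8) g)
      (D := ‖qBarMU coord f Φ r₀ (g / L) (L / 2) (L / 8) (L / 16) - qBarM coord Φ r₀ (g / L) (L / 2) (L / 8) (L / 16)‖)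
      (by positivity) hCK0 (norm_nonneg _)
    have e2 : 2 * (deltaK coord Φ r₀ (g / L) (L / 2) (L / 16) + epsSpec coord (g / L) (L / 2) g / 2) =
        2 * deltaK coord Φ r₀ (g / L) (L / 2) (L / 16) + epsSpec coord (g / L) (L / 2) g := by ring
    rw [e2] at hshape
    refine hshape.trans ?_
    rw [← hXdef]
    have hXX := add_sqrt_le_two_sqrt hX0 hX1
    calc 200 * (1 + ‖qBarMU coord f Φ r₀ (g / L) (L / 2) (L / 8) (L / 16) - qBarM coord Φ r₀ (g / L) (L / 2) (L / 8) (L / 16)‖) *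
          (X + Real.sqrt X)
        ≤ 200 * (rateKD V J * N * L / g) * (2 * (Real.sqrt (rateKX r₀ V J) * N * L * Real.sqrt ω / g)) := by
          refine mul_le_mul (mul_le_mul_of_nonneg_left hD (by norm_num)) (hXX.trans ?_) (by positivity) (by positivity)
          linarith
      _ = 400 * (rateKD V J * N * L / g) * (Real.sqrt (rateKX r₀ V J) * N * L * Real.sqrt ω / g) := by ring
  · -- `X > 1`: the bound exceeds `1/2 ≥ dist(ρ₀, ℤ)`
    rw [not_le] at hX1
    refine ⟨round ((star ψ ⬝ᵥ (regionCharge (cslab coord (zrange 0 1)) *ᵥ ψ)).re), (abs_sub_round _).trans ?_⟩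
    have hY1 : 1 < Real.sqrt (rateKX r₀ V J) * N * L * Real.sqrt ω / g :=
      one_lt_of_bound_gt hKX0.le hω0.le hg hg1 hNpos.le hLpos.le (hX1.trans_le hXb)
    have hD1 : (2 : ℝ) ≤ rateKD V J * N * L / g := by
      have hg' : (1 : ℝ) ≤ L / g := by rw [le_div_iff₀ hg]; linarith
      calc (2 : ℝ) = 2 * 1 * 1 := by ring
        _ ≤ rateKD V J * N * ((L : ℝ) / g) := by gcongr
        _ = rateKD V J * N * L / g := by ring
    exact half_le_bound hD1 hY1

end Main

end SpinLSM

end Literature.MathematicalPhysics.QuantumLattice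

end
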